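/-
Copyright (c) 2026 the pub-hodgecm-mathlib formalisation cell (harness21).  Prover seat hodgecm-mathlib-LH4-p13 (g2), req620 Track A «(D-RAM) FOUR-FRAME» squad
(heir LEAD F0P3a-plan lineage; dealer LH4-plan lineage; MS ROAD A, Stage B: the B9-0₂ UNIQUENESS half on the type-2 on-branch strata (LH4-p11 (g2) 00:18:34Z cut), AXIS 3).  2026-09-04.
-/
import Summits.HodgeConjecture.HodgeConjecture.Theorems.F0P3cDyRamDiagonalSplitCountTwo   -- ★ B4₂ FILE 2 p856191 (this seat): axis 3, type 2 (`not_two_dvd_of_isTypeTwoPolarisable_latt_axis3`); brings ★ B4 axis 3, ★ Tools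
import Summits.HodgeConjecture.HodgeConjecture.Theorems.F0P3cDyRamDiagonalSplitCountSockets   -- ★ B4 FILE 5 p856064 (this seat): `hasAxis_axis3_iff`; brings ★ StrataDefs (`HasAxis`, `stratumTwo`)
import HarnessLib

/-!
# Crux `H413`, MS ROAD A, STAGE B — B9-0₂ ON THE AXIS-3 STRATUM: THE TYPE-2 POLARISATIONS OF `M₃(s,x)` FORM ONE `S_F`-COSET (`n₂(M) = 1`, MEMO v2.1 §T2.2)

Cell `hodgecm-mathlib` (D-0151), FLOOR 0, crux item H413 = `stmt-HodgeConjecture-24833`, route of record `HCCMUnconditional`; squad F0∕P3c∕LH4 (req618∕req620).  THEOREMS ONLY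
(no `def`, no instance, no notation, no `sorry`, default heartbeats); lane `--supports stmt-HodgeConjecture-24833 --as helper` (count-neutral).  Road target: tree
`Cruxes/H413/Lines/F0_P3c_DyRamFourFrame_U3_Laws.lean` stub `stub_U3_stableModelSum` (MS), type-2 half: Stage A (O2c) at `tv = 2` needs the `hcoset` binder «the type-2
polarisations of `M₀` form ONE coset of `S_F(M₀)`» for every `M₀ ∈ 𝓛₀(T)`; ★ B9-0 p856086 (`F0P3cDyRamDiagonalPolarisationCoset`, LH4-p11 (g2)) proved the «⊇» half for every lattice
and reduced the binder to per-stratum UNIQUENESS: `∀ D₁ D, (fixed, non-zero) → IsVertexLattice σ ϖ (diag D₁) 2 M → … → IsVertexLattice σ ϖ (diag D) 2 M → ∃ u ∈ S_F(M), ∀ i, D i = D₁ i · u i`.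
THIS FILE proves that uniqueness on the AXIS-3 on-branch stratum `M = M₃(s,x) = latt (1 0 0; x ϖ^s 0; 0 0 1)` (`x` a unit) — MEMO v2.1 §T2.2: the solution set is `u₂, u₃` free,
`u₁ ≡ −u₂N(x) (𝔭_F^{(s+1)∕2})`, ONE coset of `S_F = {u : u₁ ≡ u₀ (𝔭^s)}`.

WHAT IS PROVED (generic valued field `K`; datum letters as in ★ B1).
* §1 `exponents_of_isVertexLattice_two_latt_axis3` — for ANY type-2 polarisation `diag(D)` of `M₃(s,x)`: `s` is odd and `|D₀| = |D₁| = |ϖ|^{1−s}`, `|D₂| = 1`,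
  `|D₀ + N(x)D₁| ≤ |ϖ|` — read off the Gram matrix on the HNF frame (★ `isVertexLattice_latt_iff_of_v`: `G`, `ϖG⁻¹` (explicit inverse), `|det G| = |ϖ|²`) and the parity of fixed elements.
* §2 HEAD **`typeTwoPolarisation_unique_latt_axis3`** — two polarisations `D₁`, `D` differ by `u = D∕D₁ ∈ S_F(M₃(s,x))`: `u` is a `σ`-fixed unit vector by §1, and
  `(u₁ − u₀)·D₁,₀D₁,₁ = D₁·g₁ − g·D₁,₁` with `g, g₁` the two `G₀₀`'s gives `|u₁ − u₀| ≤ |ϖ|^s`, i.e. `u ∈ S_F` (★ `mem_fixedUnitStabilizer_latt_axis3_iff`);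
* §3 sockets `typeTwoPolarisation_unique_of_hasAxis_T3` (every `M ∈ 𝓛₀(T)` with `HasAxis ϖ M (s,s,0)`, via ★ `hasAxis_axis3_iff`) and `typeTwoPolarisation_unique_stratumTwo_T3`
  (every `M ∈ stratumTwo σ ϖ T (s,s,0)`, ★ StrataDefs ED. 2).
HONEST LABEL.  Count-neutral (`--supports`); nothing printed is asserted; (MS) and the census laws stay PROVER TARGETS until the Stage B bricks and B10∕B10₂ land; `HC_CM` is proved only
modulo the 7 printed citations (2 remaining named inputs: hLiu418 = `stmt-HodgeConjecture-24832`, h413 = `stmt-HodgeConjecture-24833`) until rung 0 closes.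

## References
* [Kottwitz1986BaseChangeUnits] R. E. Kottwitz, *Base change for unit elements of Hecke algebras*, Compositio Math. 60 (1986), §1 pp. 240–241.
* [Rogawski1990] J. D. Rogawski, *Automorphic Representations of Unitary Groups in Three Variables*, Ann. of Math. Stud. 123 (1990), §4.9 Prop. 4.9.1 (a) p. 55.
* [Jacobowitz1962] R. Jacobowitz, *Hermitian forms over local fields*, Amer. J. Math. 84 (1962), §7–§8 (`𝔭`-modular lattices).
-/

set_option autoImplicit false

noncomputable section

namespace Summit.HodgeConjecture.HodgeConjecture.Cruxes.H413.F0P3cDyRamDiagonalSplitCountTwoUnique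

open Matrix
open Literature.NumberTheory.Automorphic Literature.NumberTheory.Automorphic.HermitianLattice
open Literature.NumberTheory.Automorphic.UnitaryLatticeTree
open Literature.NumberTheory.LocalFields.WildQuadraticDatum (v_varpi_pow)
open Summit.HodgeConjecture.HodgeConjecture.Cruxes.H413.F0P3cDyRamDiagonalTorusDefs
open Summit.HodgeConjecture.HodgeConjecture.Cruxes.H413.F0P3cDyRamDiagonalSplitCount
open Summit.HodgeConjecture.HodgeConjecture.Cruxes.H413.F0P3cDyRamDiagonalSplitCountTwo
open Summit.HodgeConjecture.HodgeConjecture.Cruxes.H413.F0P3cDyRamDiagonalStrataDefs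
open Summit.HodgeConjecture.HodgeConjecture.Cruxes.H413.F0P3cDyRamDiagonalSplitCountSockets (hasAxis_axis3_iff)
open Summit.HodgeConjecture.HodgeConjecture.Cruxes.H413.F0P3cDyRamDiagonalGluedTubeCriterion (formCongr_hnf_diagonal det_coe_hnf det_formCongr_diagonal)
open scoped Valued WithZero Matrix MatrixGroups

variable {K : Type*} [Field K] [Valued K ℤᵐ⁰]

/-! ## §1  The valuations of a type-2 polarisation of `M₃(s,x)` are forced -/

/-- **THE EXPONENTS OF A TYPE-2 POLARISATION OF `M₃(s,x)`.**  If `M₃(s,x)` (`x` a unit) is a type-2 vertex lattice for the `σ`-fixed non-degenerate `diag(D)`, then `s` is odd,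
`|D₀| = |D₁| = exp(s − 1)` (`= |ϖ|^{1−s}`), `|D₂| = 1`, and the Gram entry `G₀₀ = D₀ + N(x)D₁` satisfies `|G₀₀| ≤ exp(−1)` (from `ϖ·G₀₀∕det ∈ 𝒪`). [cite: Jacobowitz1962, §7–§8] -/
theorem exponents_of_isVertexLattice_two_latt_axis3 {σ : K →+* K} (hvσ : ∀ a, Valued.v (σ a) = Valued.v a)
    (hfix : ∀ x : K, σ x = x → x ≠ 0 → ∃ n : ℤ, Valued.v x = WithZero.exp (2 * n)) {ϖ : K} (hϖ : Valued.v ϖ = WithZero.exp (-1 : ℤ))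
    {x : K} (hx : Valued.v x = 1) {s : ℕ} {D : Fin 3 → K} (hD : ∀ i, σ (D i) = D i ∧ D i ≠ 0)
    (hV : IsVertexLattice σ ϖ (Matrix.diagonal D) 2 (latt (!![1, 0, 0; x, ϖ ^ s, 0; 0, 0, 1] : Matrix (Fin 3) (Fin 3) K))) :
    ¬ 2 ∣ s ∧ Valued.v (D 0) = WithZero.exp ((s : ℤ) - 1) ∧ Valued.v (D 1) = WithZero.exp ((s : ℤ) - 1) ∧ Valued.v (D 2) = 1 ∧
      Valued.v (D 0 + σ x * D 1 * x) ≤ WithZero.exp (-1 : ℤ) := by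
  have hodd : ¬ 2 ∣ s := not_two_dvd_of_isTypeTwoPolarisable_latt_axis3 hvσ hfix hϖ hx ⟨D, hD, hV⟩
  have hϖ0 : ϖ ≠ 0 := fun h0 => by rw [h0, map_zero] at hϖ; exact WithZero.coe_ne_zero hϖ.symm
  have hσx : Valued.v (σ x) = 1 := by rw [hvσ, hx]
  have hvs : Valued.v (ϖ ^ s) = WithZero.exp (-(s : ℤ)) := by rw [map_pow, v_varpi_pow hϖ]
  have hσs : Valued.v (σ (ϖ ^ s)) = WithZero.exp (-(s : ℤ)) := by rw [hvσ, hvs]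
  obtain ⟨n₀, hn₀⟩ := hfix (D 0) (hD 0).1 (hD 0).2
  obtain ⟨n₁, hn₁⟩ := hfix (D 1) (hD 1).1 (hD 1).2
  obtain ⟨n₂, hn₂⟩ := hfix (D 2) (hD 2).1 (hD 2).2
  set g : GL (Fin 3) K := Matrix.GeneralLinearGroup.mkOfDetNeZero _ (det_axis3_ne_zero hϖ0 x s) with hg
  have hG : formCongr σ g (Matrix.diagonal D) =
      !![D 0 + σ x * D 1 * x, σ x * D 1 * ϖ ^ s, 0; σ (ϖ ^ s) * D 1 * x, σ (ϖ ^ s) * D 1 * ϖ ^ s, 0; 0, 0, D 2] := by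
    rw [formCongr_hnf_diagonal σ D x 0 0 (ϖ ^ s) 1 g rfl]
    ext i j
    fin_cases i <;> fin_cases j <;> simp
  obtain ⟨hint, hinv, hdet⟩ := (isVertexLattice_latt_iff_of_v σ hvσ hϖ0 (Matrix.diagonal D) 2 g).1 hV
  have hΔ0 : D 0 * D 1 * (σ (ϖ ^ s) * ϖ ^ s) ≠ 0 :=
    mul_ne_zero (mul_ne_zero (hD 0).2 (hD 1).2) (mul_ne_zero ((map_ne_zero σ).2 (pow_ne_zero _ hϖ0)) (pow_ne_zero _ hϖ0))
  have hdet' : (-(s : ℤ)) + (2 * n₀ + 2 * n₁ + 2 * n₂) + (-(s : ℤ)) = -1 + -1 := by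
    have h := hdet
    rw [det_formCongr_diagonal σ D g, det_coe_hnf x 0 0 (ϖ ^ s) 1 g rfl, mul_one, map_mul, map_mul, map_mul, map_mul, hσs, hn₀, hn₁, hn₂, hvs, hϖ,
      ← WithZero.exp_add, ← WithZero.exp_add, ← WithZero.exp_add, ← WithZero.exp_add, pow_two, ← WithZero.exp_add, WithZero.exp_inj] at h
    exact h
  have h01 : Valued.v (σ x * D 1 * ϖ ^ s) ≤ 1 := by have h := hint 0 1; rw [hG] at h; exact h
  have h00 : Valued.v (D 0 + σ x * D 1 * x) ≤ 1 := by have h := hint 0 0; rw [hG] at h; exact h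
  have h22 : Valued.v (D 2) ≤ 1 := by have h := hint 2 2; rw [hG] at h; exact h
  have hGinv : (formCongr σ g (Matrix.diagonal D))⁻¹ =
      !![σ (ϖ ^ s) * D 1 * ϖ ^ s / (D 0 * D 1 * (σ (ϖ ^ s) * ϖ ^ s)), -(σ x * D 1 * ϖ ^ s) / (D 0 * D 1 * (σ (ϖ ^ s) * ϖ ^ s)), 0;
         -(σ (ϖ ^ s) * D 1 * x) / (D 0 * D 1 * (σ (ϖ ^ s) * ϖ ^ s)), (D 0 + σ x * D 1 * x) / (D 0 * D 1 * (σ (ϖ ^ s) * ϖ ^ s)), 0;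
         0, 0, (D 2)⁻¹] := by
    rw [hG]
    refine Matrix.inv_eq_right_inv ?_
    have h0 := (hD 0).2
    have h1 := (hD 1).2
    have h2 := (hD 2).2
    have hs0 : σ (ϖ ^ s) ≠ 0 := (map_ne_zero σ).2 (pow_ne_zero _ hϖ0)
    have hσϖ : σ ϖ ≠ 0 := (map_ne_zero σ).2 hϖ0
    have hp0 : (ϖ ^ s : K) ≠ 0 := pow_ne_zero _ hϖ0
    ext i j
    fin_cases i <;> fin_cases j <;> simp [Matrix.mul_apply, Fin.sum_univ_three] <;> field_simp <;> ring
  have i10 : Valued.v (ϖ * (-(σ (ϖ ^ s) * D 1 * x) / (D 0 * D 1 * (σ (ϖ ^ s) * ϖ ^ s)))) ≤ 1 := by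
    have h := hinv 1 0; rw [hGinv, Matrix.smul_apply, smul_eq_mul] at h; exact h
  have i11 : Valued.v (ϖ * ((D 0 + σ x * D 1 * x) / (D 0 * D 1 * (σ (ϖ ^ s) * ϖ ^ s)))) ≤ 1 := by
    have h := hinv 1 1; rw [hGinv, Matrix.smul_apply, smul_eq_mul] at h; exact h
  have i22 : Valued.v (ϖ * (D 2)⁻¹) ≤ 1 := by
    have h := hinv 2 2; rw [hGinv, Matrix.smul_apply, smul_eq_mul] at h; exact h
  have hΔpos : 0 < Valued.v (D 0 * D 1 * (σ (ϖ ^ s) * ϖ ^ s)) := (Valuation.pos_iff _).2 hΔ0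
  have vΔ : Valued.v (D 0 * D 1 * (σ (ϖ ^ s) * ϖ ^ s)) = WithZero.exp (2 * n₀ + 2 * n₁ + (-(s : ℤ) + -(s : ℤ))) := by
    rw [map_mul, map_mul, map_mul, hn₀, hn₁, hσs, hvs, ← WithZero.exp_add, ← WithZero.exp_add, ← WithZero.exp_add]
  have e22 : n₂ = 0 := by
    rw [hn₂, ← WithZero.exp_zero, WithZero.exp_le_exp] at h22
    rw [map_mul, map_inv₀, hϖ, hn₂, ← WithZero.exp_neg, ← WithZero.exp_add, ← WithZero.exp_zero, WithZero.exp_le_exp] at i22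
    omega
  have e01 : 2 * n₁ - (s : ℤ) ≤ 0 := by
    rw [map_mul, map_mul, hσx, one_mul, hn₁, hvs, ← WithZero.exp_add, ← WithZero.exp_zero, WithZero.exp_le_exp] at h01
    omega
  have e10 : (s : ℤ) - 1 ≤ 2 * n₀ := by
    rw [map_mul, map_div₀, ← mul_div_assoc, div_le_one₀ hΔpos, Valuation.map_neg, map_mul, map_mul, hσs, hn₁, hx, mul_one, hϖ, vΔ,
      ← WithZero.exp_add, ← WithZero.exp_add, WithZero.exp_le_exp] at i10
    omega
  obtain ⟨m, rfl⟩ : ∃ m, s = 2 * m + 1 := ⟨s / 2, by omega⟩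
  -- `n₀ = m`: otherwise `n₀ > n₁`, `|G₀₀| = |D₀| ≤ 1` forces `n₀ ≤ 0 < m + 1 ≤ n₀`
  have hn₀m : n₀ = (m : ℤ) := by
    by_contra hne
    have hlt : Valued.v (σ x * D 1 * x) < Valued.v (D 0) := by
      rw [map_mul, map_mul, hσx, hx, one_mul, mul_one, hn₁, hn₀, WithZero.exp_lt_exp]
      push_cast at hdet' e01 e10
      omega
    have e00 : n₀ ≤ 0 := by
      rw [Valuation.map_add_eq_of_lt_left _ hlt, hn₀, ← WithZero.exp_zero, WithZero.exp_le_exp] at h00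
      omega
    push_cast at hdet' e01 e10
    omega
  have hn₁m : n₁ = (m : ℤ) := by push_cast at hdet'; omega
  refine ⟨hodd, ?_, ?_, ?_, ?_⟩
  · rw [hn₀, hn₀m]; push_cast; ring_nf
  · rw [hn₁, hn₁m]; push_cast; ring_nf
  · rw [hn₂, e22, mul_zero, WithZero.exp_zero]
  · -- `|ϖ·G₀₀| ≤ |Δ| = exp(−2)`
    rw [map_mul, map_div₀, ← mul_div_assoc, div_le_one₀ hΔpos, hϖ, vΔ, hn₀m, hn₁m] at i11
    rcases eq_or_ne (D 0 + σ x * D 1 * x) 0 with h0 | h0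
    · rw [h0, map_zero]; exact zero_le
    · obtain ⟨k, hk⟩ : ∃ k : ℤ, Valued.v (D 0 + σ x * D 1 * x) = WithZero.exp k :=
        ⟨_, (WithZero.coe_unzero ((Valuation.ne_zero_iff _).2 h0)).symm⟩
      rw [hk, ← WithZero.exp_add, WithZero.exp_le_exp] at i11
      rw [hk, WithZero.exp_le_exp]
      push_cast at i11
      omega

/-! ## §2  Uniqueness: two type-2 polarisations differ by an element of `S_F(M₃(s,x))` -/

/-- **B9-0₂ UNIQUENESS ON THE AXIS-3 STRATUM.**  If `diag(D₁)` and `diag(D)` are two `σ`-fixed non-degenerate diagonal forms for which `M₃(s,x)` (`x` a unit) is a type-2 vertex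
lattice, then `D = D₁·u` for some `u ∈ S_F(M₃(s,x))` (`u = D∕D₁` is a fixed unit vector by §1, and `|u₁ − u₀| ≤ |ϖ|^s` from the two `G₀₀`-bounds) — the polarisations form ONE
`S_F`-coset, `n₂ = 1` (MEMO v2.1 §T2.2). [cite: Kottwitz1986BaseChangeUnits, §1 pp. 240–241] [cite: Rogawski1990, §4.9 Prop. 4.9.1 (a) p. 55] -/
theorem typeTwoPolarisation_unique_latt_axis3 {σ : K →+* K} (hvσ : ∀ a, Valued.v (σ a) = Valued.v a)
    (hfix : ∀ x : K, σ x = x → x ≠ 0 → ∃ n : ℤ, Valued.v x = WithZero.exp (2 * n)) {ϖ : K} (hϖ : Valued.v ϖ = WithZero.exp (-1 : ℤ))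
    {x : K} (hx : Valued.v x = 1) {s : ℕ} (D₁ D : Fin 3 → K) (hD₁ : ∀ i, σ (D₁ i) = D₁ i ∧ D₁ i ≠ 0)
    (hV₁ : IsVertexLattice σ ϖ (Matrix.diagonal D₁) 2 (latt (!![1, 0, 0; x, ϖ ^ s, 0; 0, 0, 1] : Matrix (Fin 3) (Fin 3) K)))
    (hD : ∀ i, σ (D i) = D i ∧ D i ≠ 0) (hV : IsVertexLattice σ ϖ (Matrix.diagonal D) 2 (latt (!![1, 0, 0; x, ϖ ^ s, 0; 0, 0, 1] : Matrix (Fin 3) (Fin 3) K))) :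
    ∃ u ∈ fixedUnitStabilizer σ (latt (!![1, 0, 0; x, ϖ ^ s, 0; 0, 0, 1] : Matrix (Fin 3) (Fin 3) K)), ∀ i, D i = D₁ i * (u i : K) := by
  have hϖ0 : ϖ ≠ 0 := fun h0 => by rw [h0, map_zero] at hϖ; exact WithZero.coe_ne_zero hϖ.symm
  have hvs : Valued.v (ϖ ^ s) = WithZero.exp (-(s : ℤ)) := by rw [map_pow, v_varpi_pow hϖ]
  obtain ⟨-, e₀, e₁, e₂, g₁⟩ := exponents_of_isVertexLattice_two_latt_axis3 hvσ hfix hϖ hx hD₁ hV₁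
  obtain ⟨-, f₀, f₁, f₂, g⟩ := exponents_of_isVertexLattice_two_latt_axis3 hvσ hfix hϖ hx hD hV
  -- the quotient `u = D ∕ D₁`, a `σ`-fixed unit vector
  have hval : ∀ i, Valued.v (D i / D₁ i) = 1 := by
    intro i
    rw [map_div₀]
    fin_cases i
    · show Valued.v (D 0) / Valued.v (D₁ 0) = 1; rw [f₀, e₀, div_self (WithZero.coe_ne_zero)]
    · show Valued.v (D 1) / Valued.v (D₁ 1) = 1; rw [f₁, e₁, div_self (WithZero.coe_ne_zero)]
    · show Valued.v (D 2) / Valued.v (D₁ 2) = 1; rw [f₂, e₂, div_one]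
  have hne : ∀ i, D i / D₁ i ≠ 0 := fun i => div_ne_zero (hD i).2 (hD₁ i).2
  refine ⟨fun i => Units.mk0 (D i / D₁ i) (hne i), ?_, fun i => ?_⟩
  · rw [mem_fixedUnitStabilizer_latt_axis3_iff σ hϖ0 hx s]
    refine ⟨(mem_fixedUnitTorus_iff σ _).2 ⟨fun i => by rw [Units.val_mk0]; exact hval i, fun i => by
      rw [Units.val_mk0, map_div₀, (hD i).1, (hD₁ i).1]⟩, ?_⟩
    -- `(u₁ − u₀)·D₁,₀·D₁,₁ = D₁,₀·D 1 − D 0·D₁,₁ = D 1·g₁ − g·D₁,₁`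
    show Valued.v (D 1 / D₁ 1 - D 0 / D₁ 0) ≤ Valued.v (ϖ ^ s)
    have h10 := (hD₁ 0).2
    have h11 := (hD₁ 1).2
    have key : D 1 / D₁ 1 - D 0 / D₁ 0 = (D 1 * (D₁ 0 + σ x * D₁ 1 * x) - (D 0 + σ x * D 1 * x) * D₁ 1) / (D₁ 0 * D₁ 1) := by
      field_simp
      ring
    rw [key, map_div₀, map_mul, e₀, e₁, ← WithZero.exp_add, hvs]
    have hnum : Valued.v (D 1 * (D₁ 0 + σ x * D₁ 1 * x) - (D 0 + σ x * D 1 * x) * D₁ 1) ≤ WithZero.exp ((s : ℤ) - 1 + -1) := by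
      refine (Valuation.map_sub _ _ _).trans (max_le ?_ ?_)
      · rw [map_mul, f₁, WithZero.exp_add]; exact mul_le_mul_right g₁ _
      · rw [map_mul, e₁, mul_comm, WithZero.exp_add]; exact mul_le_mul_right g _
    rw [div_le_iff₀ (WithZero.zero_lt_coe _), ← WithZero.exp_add]
    refine hnum.trans ?_
    rw [WithZero.exp_le_exp]; omega
  · rw [Units.val_mk0, mul_div_cancel₀ _ (hD₁ i).2]

/-! ## §3  The socket forms: uniqueness for every lattice of axis vector `(s,s,0)`, and on `stratumTwo σ ϖ T (s,s,0)` -/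

/-- **B9-0₂ UNIQUENESS, AXIS VECTOR `(s,s,0)`** (`s ≥ 1`): for every normalised `T`-stable lattice `M` with `M ∩ K·eᵢ = 𝔭^{(s,s,0)ᵢ}eᵢ` — by ★ `hasAxis_axis3_iff` these are
exactly the `M₃(s,x)`, `x` a unit — two type-2 polarisations differ by an element of `S_F(M)`; the shape LH4-p11 (g2)'s ★ `hcoset_of_forall_unique` consumes, stratum by stratum.
[cite: Kottwitz1986BaseChangeUnits, §1 pp. 240–241] -/
theorem typeTwoPolarisation_unique_of_hasAxis_T3 {σ : K →+* K} (hvσ : ∀ a, Valued.v (σ a) = Valued.v a)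
    (hfix : ∀ x : K, σ x = x → x ≠ 0 → ∃ n : ℤ, Valued.v x = WithZero.exp (2 * n)) {ϖ : K} (hϖ : Valued.v ϖ = WithZero.exp (-1 : ℤ))
    {T : GL (Fin 3) K} {M : Submodule 𝒪[K] (Fin 3 → K)} (hM : M ∈ normalisedStableLattices T) {s : ℕ} (hs : 1 ≤ s) (ha : HasAxis ϖ M ![s, s, 0])
    (D₁ D : Fin 3 → K) (hD₁ : ∀ i, σ (D₁ i) = D₁ i ∧ D₁ i ≠ 0) (hV₁ : IsVertexLattice σ ϖ (Matrix.diagonal D₁) 2 M)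
    (hD : ∀ i, σ (D i) = D i ∧ D i ≠ 0) (hV : IsVertexLattice σ ϖ (Matrix.diagonal D) 2 M) :
    ∃ u ∈ fixedUnitStabilizer σ M, ∀ i, D i = D₁ i * (u i : K) := by
  obtain ⟨x, hx, rfl⟩ := (hasAxis_axis3_iff hϖ hM hs).1 ha
  exact typeTwoPolarisation_unique_latt_axis3 hvσ hfix hϖ hx D₁ D hD₁ hV₁ hD hV

/-- **B9-0₂ UNIQUENESS ON `stratumTwo σ ϖ T (s,s,0)`** (`s ≥ 1`): the same, indexed by the ★ StrataDefs ED. 2 type-2 stratum of the B10₂ partition.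
[cite: Kottwitz1986BaseChangeUnits, §1 pp. 240–241] -/
theorem typeTwoPolarisation_unique_stratumTwo_T3 {σ : K →+* K} (hvσ : ∀ a, Valued.v (σ a) = Valued.v a)
    (hfix : ∀ x : K, σ x = x → x ≠ 0 → ∃ n : ℤ, Valued.v x = WithZero.exp (2 * n)) {ϖ : K} (hϖ : Valued.v ϖ = WithZero.exp (-1 : ℤ))
    {T : GL (Fin 3) K} {s : ℕ} (hs : 1 ≤ s) {M : Submodule 𝒪[K] (Fin 3 → K)} (hM : M ∈ stratumTwo σ ϖ T ![s, s, 0])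
    (D₁ D : Fin 3 → K) (hD₁ : ∀ i, σ (D₁ i) = D₁ i ∧ D₁ i ≠ 0) (hV₁ : IsVertexLattice σ ϖ (Matrix.diagonal D₁) 2 M)
    (hD : ∀ i, σ (D i) = D i ∧ D i ≠ 0) (hV : IsVertexLattice σ ϖ (Matrix.diagonal D) 2 M) :
    ∃ u ∈ fixedUnitStabilizer σ M, ∀ i, D i = D₁ i * (u i : K) :=
  typeTwoPolarisation_unique_of_hasAxis_T3 hvσ hfix hϖ hM.1 hs hM.2.2 D₁ D hD₁ hV₁ hD hV

end Summit.HodgeConjecture.HodgeConjecture.Cruxes.H413.F0P3cDyRamDiagonalSplitCountTwoUnique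

end
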